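import Summits.RiemannHypothesis.RiemannHypothesis.Theorems.TiltedLandingLaw421R3TouchedGlueWDefs

/-!
# Glue v5, part 2 — ★A from the T⁗ socket + Γ3′ + Γ4 + FIT_W over the REPAIRED potential Φ̃_L (lens-2 g7; (CA680)(D2); HELD; 0 sorry)
= §G2/§G4/§G5 of glue v5 `lens2/TouchedGlueW-v1.lean` 1bf6780b (= glue v4 `lens2/TouchedGlue-sketch-v4.lean` dbae8648 with the DECLDIFF
`lens2/GLUE-V5-DECLDIFF-v1.md` f8dc3f57), the definitions and bookkeeping living in part 1 `…R3TouchedGlueWDefs` (the ONE import).  DECLDIFF summary: (i) the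
global constant `c` became the frame functional `cF : Budget` of the socket `TouchedDissipationLawWQ cF L κ₀` (module `…R3TouchedDissipationW`);
T⁗ = the instance `cF = weightedConstQ c θ`; (ii) crit-1's PRICE-HOLE repair: the potential is `Φ̃` (`betaPotentialWQ`), so nothing is booked before the
frame's first β-level; (iii) FIT_W per frame `betaPurseWQ cF L + aT + aRest ≤ budget`, and for T⁗ the TWO-BRACKET form
`φ₀·(Hs/s)² + φ₀·θ·(B+1) + aT + aRest ≤ approachBudgetHalfQ riseSupQ consSupQ` (`approachC_of_TQ_brackets`; `φ₀ = (1+2L+2L²)/(2c)`).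
CONTENT: §G2 the named gaps Γ2′ `PersistenceOrRetouchQ κ₀` (census dichotomy, not a binder) and Γ3′ `TouchRiseLawWQ cF L κ₀ aT` (LOAD-BEARING, OPEN as to
size); §G4 ★★ `betaClassLaw_of_TW : (∀ legal F, 0 < cF F) → 0 ≤ L → W(cF, L, κ₀) → Γ3′ → ClassLawQ (BetaLevelQ κ₀) (betaPurseWQ cF L + aT)` PROVED over
the tree's `classLawQ_of_potential_rises`; §G5 ★★ `approachC_of_TW` (+ Γ4 `ClassLawQ (Approach ∖ β) aRest` + FIT_W ⇒ `ApproachAllowanceQ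
(approachBudgetHalfQ aR aC)`), `approachC_of_TW_canonical` (conclusion = the registry's `stub_approachC` type verbatim) and `approachC_of_TQ_brackets`.
★A DECOMPOSITION OF RECORD rev 7: C′ + T⁗(c, L, κ₀, θ) + Γ2′ + Γ3′(Σ RTB ≤ aT) + Γ4 + FIT_W, all constants PARAMETERS (instance of record in
`…R3TouchedDissipationWInstance`); numbers only from certified rows.  Nothing here bears on the truth of RH; RH is not proved; T⁗/Γ3′/Γ4 are LAWS (typed,
unproved), C′ typed not proved; ★A / 33346 / 33347 OPEN; checked ≠ landed ≠ proved. -/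

namespace RhW08.TouchedGlueW

open Complex
open scoped ComplexConjugate
open RhW08.Round1 RhW08.StSwap RhW08.Round2 RhW08.QuadW
open RhW08.SealSwap (PBot)
open RhW08.SealSwapQ RhW08.RateSplit RhW08.BurgersRate RhW08.BurgersRateG3 RhW08.TouchedDissipation RhW08.TouchedDissipationW
open RhIdea6.G17.W07C7 RhIdea6.G17.W07C7.Rev6 RhIdea6.G18.W07C8.Law421BirthS RhIdea6.G19.W07C11.Seam
open RhIdea6.G20.W07C12.Frac RhIdea6.G20.W07C12.StColP RhW07.C12.FieldSplit RhIdea6.G21.W07C13.TentMax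
open RhW07.C14.TwoSided RhW07.C14.Classes RhW07.C14.Lineage RhW07.C14.Booking

/-! ## §G2 The named gaps (typed, OPEN — hypotheses of the glue, not sorries) -/

/-- (Γ2′ — CENSUS DICHOTOMY, NOT a binder of the glue) at a β-level either the next pair energy is at most the children's energy in `Ū` (persistence:
`RTB_k = 0`) or the next lowest state has a toucher OUTSIDE `Ū` (a RETOUCH, priced by `RTB_k`; price note `lens2/RETOUCH-PRICE-NOTE-v1.md`). -/
def PersistenceOrRetouchQ (κ₀ : ℝ) : Prop :=
  ∀ (η : ℝ) (f : ℂ → ℂ) (x₀ s hmax R Hs : ℝ) (B : ℕ), EngineHyps5 2 η f x₀ s hmax R Hs B →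
    ∀ (j : ℕ) (v z : ℂ), Charged (PTrkSQ PBot) StTrkDQ ReadyR2 η f x₀ s hmax R Hs B j → ApproachLevelQ η f x₀ s hmax R Hs B j →
      IsLowest StTrkDQ η f x₀ s hmax R Hs B j v → Touches f j v z → AtomicPair f j v z → κ₀ ≤ v.im * stateKappa f j v →
      touchEnergyQ η f x₀ s hmax R Hs B (j + 1) ≤ childEnergy f j (pairUnion v z) ∨
        ∃ v' ρ : ℂ, IsLowest StTrkDQ η f x₀ s hmax R Hs B (j + 1) v' ∧ Touches f (j + 1) v' ρ ∧ ρ ∉ pairUnion v z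

/-- (Γ3′, OPEN as to SIZE — LOAD-BEARING) RISE ALLOWANCE in Φ̃ units: before the horizon the booked rises `touchRiseWQ` stay within `aT`. -/
def TouchRiseLawWQ (cF : Budget) (L κ₀ : ℝ) (aT : Budget) : Prop :=
  ∀ (η : ℝ) (f : ℂ → ℂ) (x₀ s hmax R Hs : ℝ) (B : ℕ), EngineHyps5 2 η f x₀ s hmax R Hs B →
    ∀ k : ℕ, Charged (PTrkSQ PBot) StTrkDQ ReadyR2 η f x₀ s hmax R Hs B k →
      prefixSumQ (touchRiseWQ cF L κ₀) η f x₀ s hmax R Hs B (k + 1) ≤ aT η f x₀ s hmax R Hs B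

/-! ## §G4 ★ The β class law from the socket + Γ3′ — PROVED (no persistence hypothesis, no state cap) -/

open Classical in
set_option maxHeartbeats 800000 in
/-- ★★ (K) **W(cF) + RISE ALLOWANCE ⟹ the β CLASS LAW** with allowance `betaPurseWQ cF L + aT`, by the books' socket `classLawQ_of_potential_rises` with
`Φ = Φ̃` and rise meter `touchRiseWQ`: at a charged β-level `k` (so `firstBetaQ ≤ k` and Φ̃ = Φ_L there and at `k+1`)
`Φ_L(E_k) ≥ Φ_L(e_k) ≥ Φ_L(childEnergy Ū_k) + 1 ≥ Φ_L(E_{k+1}) − RTB_k + 1` (monotonicity; the paying inequality at the pair energy `e_k` read against the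
socket row at the frame constant `cF(F) > 0`; the definition of `RTB_k`); off β-levels `Φ̃(k+1) − Φ̃(k) ≤ meter`. -/
theorem betaClassLaw_of_TW {cF : Budget} {L κ₀ : ℝ} {aT : Budget}
    (hcF : ∀ (η : ℝ) (f : ℂ → ℂ) (x₀ s hmax R Hs : ℝ) (B : ℕ), EngineHyps5 2 η f x₀ s hmax R Hs B → 0 < cF η f x₀ s hmax R Hs B)
    (hL : 0 ≤ L) (hT : TouchedDissipationLawWQ cF L κ₀) (hrise : TouchRiseLawWQ cF L κ₀ aT) :
    ClassLawQ (BetaLevelQ κ₀) (addBudget (betaPurseWQ cF L) aT) := by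
  refine classLawQ_of_potential_rises (betaPotentialWQ cF L κ₀) (touchRiseWQ cF L κ₀) ?_
  intro η f x₀ s hmax R Hs B hE
  have hc : 0 < cF η f x₀ s hmax R Hs B := hcF η f x₀ s hmax R Hs B hE
  have hs : 0 < s := hE.2.2.2.1
  have hHs0 : 0 ≤ Hs := hE.2.2.2.2.2.2.2.1
  have hη0 : 0 ≤ η := hE.2.2.2.2.2.2.2.2.2.2.2.2.2.1
  have hη1 : 2 * η ≤ 1 := hE.2.2.2.2.2.2.2.2.2.2.2.2.2.2.1
  have hpurse0 : 0 ≤ betaPurseWQ cF L η f x₀ s hmax R Hs B := by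
    rw [betaPurseWQ_apply]
    exact div_nonneg (mul_nonneg (by nlinarith) (sq_nonneg _)) (by positivity)
  have hΦle : ∀ k : ℕ, firstBetaQ κ₀ η f x₀ s hmax R Hs B ≤ k →
      betaPotentialWQ cF L κ₀ η f x₀ s hmax R Hs B k ≤ betaPurseWQ cF L η f x₀ s hmax R Hs B := fun k hk => by
    rw [betaPotentialWQ_of_le hk, betaPurseWQ_apply]
    exact phiLE_le_purse hc hL hs hη0 hη1 hHs0 (touchEnergyQ_nonneg η f x₀ s hmax R Hs B k) (touchEnergyQ_le hE k)
  refine ⟨fun k => ?_, ?_, fun k hk => hrise η f x₀ s hmax R Hs B hE k hk, fun k _ => ?_⟩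
  · by_cases hk : k < firstBetaQ κ₀ η f x₀ s hmax R Hs B
    · rw [betaPotentialWQ_of_lt hk]; exact hpurse0
    · rw [betaPotentialWQ_of_le (not_lt.1 hk)]
      exact phiLE_nonneg hc L η s Hs (touchEnergyQ_nonneg η f x₀ s hmax R Hs B k)
  · show betaPotentialWQ cF L κ₀ η f x₀ s hmax R Hs B 0 ≤ betaPurseWQ cF L η f x₀ s hmax R Hs B
    by_cases h0 : 0 < firstBetaQ κ₀ η f x₀ s hmax R Hs B
    · rw [betaPotentialWQ_of_lt h0]
    · exact hΦle 0 (Nat.le_of_not_lt h0)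
  · -- the step across level `k`
    have hdrop : -(4 * dropQ η f x₀ s hmax R Hs B k / s) ≤ 4 * max (-dropQ η f x₀ s hmax R Hs B k) 0 / s := by
      rw [← neg_div, ← mul_neg]
      exact div_le_div_of_nonneg_right (mul_le_mul_of_nonneg_left (le_max_left _ _) (by norm_num)) hs.le
    have hm1 : betaPotentialWQ cF L κ₀ η f x₀ s hmax R Hs B (k + 1) - betaPotentialWQ cF L κ₀ η f x₀ s hmax R Hs B k
        ≤ max (max (betaPotentialWQ cF L κ₀ η f x₀ s hmax R Hs B (k + 1) - betaPotentialWQ cF L κ₀ η f x₀ s hmax R Hs B k) 0)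
            (retouchRiseWQ cF L κ₀ η f x₀ s hmax R Hs B k) := (le_max_left _ _).trans (le_max_left _ _)
    have hR' : retouchRiseWQ cF L κ₀ η f x₀ s hmax R Hs B k
        ≤ max (max (betaPotentialWQ cF L κ₀ η f x₀ s hmax R Hs B (k + 1) - betaPotentialWQ cF L κ₀ η f x₀ s hmax R Hs B k) 0)
            (retouchRiseWQ cF L κ₀ η f x₀ s hmax R Hs B k) := le_max_right _ _
    have hd0 : 0 ≤ 4 * max (-dropQ η f x₀ s hmax R Hs B k) 0 / s := by positivity
    by_cases hj : Charged (PTrkSQ PBot) StTrkDQ ReadyR2 η f x₀ s hmax R Hs B k ∧ BetaLevelQ κ₀ η f x₀ s hmax R Hs B k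
    · rw [if_pos hj]
      obtain ⟨hch, hβ⟩ := hj
      have hfb : firstBetaQ κ₀ η f x₀ s hmax R Hs B ≤ k := firstBetaQ_le hβ
      obtain ⟨happ, v, z, hlow, ht, ha, hfl⟩ := hβ
      have hex : ∃ p : ℂ × ℂ, BetaWitnessQ κ₀ η f x₀ s hmax R Hs B k p := ⟨(v, z), hch, happ, hlow, ht, ha, hfl⟩
      obtain ⟨hch', happ', hlow', ht', ha', hfl'⟩ := Classical.choose_spec hex
      have hRTB : retouchRiseWQ cF L κ₀ η f x₀ s hmax R Hs B k
          = max (phiLE (cF η f x₀ s hmax R Hs B) L η s Hs (touchEnergyQ η f x₀ s hmax R Hs B (k + 1))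
              - phiLE (cF η f x₀ s hmax R Hs B) L η s Hs
                  (childEnergy f k (pairUnion (Classical.choose hex).1 (Classical.choose hex).2))) 0 := by
        unfold retouchRiseWQ; rw [dif_pos hex]
      have hΦk := betaPotentialWQ_of_le (cF := cF) (L := L) hfb
      have hΦk1 := betaPotentialWQ_of_le (cF := cF) (L := L) (hfb.trans (Nat.le_succ k))
      -- the chosen pair's energies
      have hrow := hT η f x₀ s hmax R Hs B hE k _ _ hch' happ' hlow' ht' ha' hfl'
      have hΔ0 := drop_nonneg_of_lawWQ hT hE hc hch' happ' hlow' ht' ha' hfl'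
      obtain ⟨he2, hHs⟩ := pair_le_twoHsSq hE hlow' ht'
      have hcE0 : 0 ≤ childEnergy f k (pairUnion (Classical.choose hex).1 (Classical.choose hex).2) := childEnergy_nonneg _ _ _
      have hcEe : childEnergy f k (pairUnion (Classical.choose hex).1 (Classical.choose hex).2)
          ≤ (Classical.choose hex).1.im ^ 2 + (Classical.choose hex).2.im ^ 2 := by linarith
      have heE := pair_le_touchEnergyQ hE hlow' ht'
      have hEk2 := touchEnergyQ_le hE k
      -- (1) the potential pays at least one unit between the pair energy and the children's energy
      have htan := phiLE_sub_ge (η := η) (s := s) hc hL hHs hcE0 hcEe he2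
      have hunit : 1 ≤ η ^ 2 / (cF η f x₀ s hmax R Hs B * s ^ 2)
          * (logWeight L Hs ((Classical.choose hex).1.im ^ 2 + (Classical.choose hex).2.im ^ 2) ^ 2
            * (((Classical.choose hex).1.im ^ 2 + (Classical.choose hex).2.im ^ 2)
              - childEnergy f k (pairUnion (Classical.choose hex).1 (Classical.choose hex).2))) := by
        rw [div_mul_eq_mul_div, le_div_iff₀ (by positivity), one_mul]
        linarith
      have hpay := hunit.trans htan
      -- (2) monotonicity from the pair energy up to the meter
      have hmono := phiLE_mono (η := η) (s := s) hc hL hHs (by positivity) heE hEk2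
      -- (3) the retouch rise covers the rest
      have hR : phiLE (cF η f x₀ s hmax R Hs B) L η s Hs (touchEnergyQ η f x₀ s hmax R Hs B (k + 1))
          - phiLE (cF η f x₀ s hmax R Hs B) L η s Hs (childEnergy f k (pairUnion (Classical.choose hex).1 (Classical.choose hex).2))
          ≤ retouchRiseWQ cF L κ₀ η f x₀ s hmax R Hs B k := by rw [hRTB]; exact le_max_left _ _
      show betaPotentialWQ cF L κ₀ η f x₀ s hmax R Hs B (k + 1) + (1 - 4 * dropQ η f x₀ s hmax R Hs B k / s)
        ≤ betaPotentialWQ cF L κ₀ η f x₀ s hmax R Hs B k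
          + (max (max (betaPotentialWQ cF L κ₀ η f x₀ s hmax R Hs B (k + 1) - betaPotentialWQ cF L κ₀ η f x₀ s hmax R Hs B k) 0)
              (retouchRiseWQ cF L κ₀ η f x₀ s hmax R Hs B k)
            + 4 * max (-dropQ η f x₀ s hmax R Hs B k) 0 / s)
      rw [hΦk, hΦk1] at hm1 hR' ⊢
      linarith
    · rw [if_neg hj, add_zero]
      show betaPotentialWQ cF L κ₀ η f x₀ s hmax R Hs B (k + 1)
        ≤ betaPotentialWQ cF L κ₀ η f x₀ s hmax R Hs B k
          + (max (max (betaPotentialWQ cF L κ₀ η f x₀ s hmax R Hs B (k + 1) - betaPotentialWQ cF L κ₀ η f x₀ s hmax R Hs B k) 0)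
              (retouchRiseWQ cF L κ₀ η f x₀ s hmax R Hs B k)
            + 4 * max (-dropQ η f x₀ s hmax R Hs B k) 0 / s)
      linarith

/-! ## §G5 ★★ Composition to ★A's literal type -/

/-- (K) class laws are MONOTONE in the allowance (on legal frames). -/
theorem classLawQ_mono {𝓚 : LevelClass} {a a' : Budget} (h : ClassLawQ 𝓚 a)
    (hle : ∀ (η : ℝ) (f : ℂ → ℂ) (x₀ s hmax R Hs : ℝ) (B : ℕ), EngineHyps5 2 η f x₀ s hmax R Hs B →
      a η f x₀ s hmax R Hs B ≤ a' η f x₀ s hmax R Hs B) : ClassLawQ 𝓚 a' :=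
  fun η f x₀ s hmax R Hs B hE k hk => (h η f x₀ s hmax R Hs B hE k hk).trans (hle η f x₀ s hmax R Hs B hE)

/-- (K) ★A's class reassembled: a β class law and a law for the REST of the approach class give `ApproachAllowanceQ (aβ + aRest)`. -/
theorem approachAllowanceQ_of_beta_rest {κ₀ : ℝ} {aβ aRest : Budget} (hβ : ClassLawQ (BetaLevelQ κ₀) aβ)
    (hrest : ClassLawQ (diffClass ApproachLevelQ (BetaLevelQ κ₀)) aRest) : ApproachAllowanceQ (addBudget aβ aRest) := by
  have hU := classLawQ_union hβ hrest
  exact classLawQ_congr (fun η f x₀ s hmax R Hs B j => ⟨fun h => h.elim (fun hb => hb.1) id, fun h => Or.inr h⟩) hU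

/-- ★★ (K, modulo the NAMED hypotheses) **THE GLUE v5**: W(cF) with `cF > 0` on legal frames + (Γ3′) RISE ALLOWANCE + (Γ4) the rest of the approach class
+ FIT_W ⟹ `ApproachAllowanceQ (approachBudgetHalfQ aR aC)` for ANY budgets `aR aC` the fit is stated against. -/
theorem approachC_of_TW {cF : Budget} {L κ₀ : ℝ} {aT aRest aR aC : Budget}
    (hcF : ∀ (η : ℝ) (f : ℂ → ℂ) (x₀ s hmax R Hs : ℝ) (B : ℕ), EngineHyps5 2 η f x₀ s hmax R Hs B → 0 < cF η f x₀ s hmax R Hs B)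
    (hL : 0 ≤ L) (hT : TouchedDissipationLawWQ cF L κ₀) (hrise : TouchRiseLawWQ cF L κ₀ aT)
    (hrest : ClassLawQ (diffClass ApproachLevelQ (BetaLevelQ κ₀)) aRest)
    (hfit : ∀ (η : ℝ) (f : ℂ → ℂ) (x₀ s hmax R Hs : ℝ) (B : ℕ), EngineHyps5 2 η f x₀ s hmax R Hs B →
      betaPurseWQ cF L η f x₀ s hmax R Hs B + aT η f x₀ s hmax R Hs B + aRest η f x₀ s hmax R Hs B
        ≤ approachBudgetHalfQ aR aC η f x₀ s hmax R Hs B) :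
    ApproachAllowanceQ (approachBudgetHalfQ aR aC) :=
  classLawQ_mono (approachAllowanceQ_of_beta_rest (betaClassLaw_of_TW hcF hL hT hrise) hrest)
    (fun η f x₀ s hmax R Hs B hE => by
      show betaPurseWQ cF L η f x₀ s hmax R Hs B + aT η f x₀ s hmax R Hs B + aRest η f x₀ s hmax R Hs B ≤ _
      exact hfit η f x₀ s hmax R Hs B hE)

/-- ★★ (K) the CANONICAL instance — literally the registry's `stub_approachC` conclusion `ApproachAllowanceQ (approachBudgetHalfQ riseSupQ consSupQ)`. -/
theorem approachC_of_TW_canonical {cF : Budget} {L κ₀ : ℝ} {aT aRest : Budget}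
    (hcF : ∀ (η : ℝ) (f : ℂ → ℂ) (x₀ s hmax R Hs : ℝ) (B : ℕ), EngineHyps5 2 η f x₀ s hmax R Hs B → 0 < cF η f x₀ s hmax R Hs B)
    (hL : 0 ≤ L) (hT : TouchedDissipationLawWQ cF L κ₀) (hrise : TouchRiseLawWQ cF L κ₀ aT)
    (hrest : ClassLawQ (diffClass ApproachLevelQ (BetaLevelQ κ₀)) aRest)
    (hfit : ∀ (η : ℝ) (f : ℂ → ℂ) (x₀ s hmax R Hs : ℝ) (B : ℕ), EngineHyps5 2 η f x₀ s hmax R Hs B →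
      betaPurseWQ cF L η f x₀ s hmax R Hs B + aT η f x₀ s hmax R Hs B + aRest η f x₀ s hmax R Hs B
        ≤ approachBudgetHalfQ riseSupQ consSupQ η f x₀ s hmax R Hs B) :
    ApproachAllowanceQ (approachBudgetHalfQ riseSupQ consSupQ) :=
  approachC_of_TW hcF hL hT hrise hrest hfit

/-- ★★ (K) **T⁗ INSTANCE WITH THE TWO-BRACKET FIT_W**: since `w_F ≤ 1 + θ·(B+1)·(s/Hs)²`, the weighted purse is at most `φ₀·(Hs/s)² + φ₀·θ·(B+1)`
(`φ₀ = (1+2L+2L²)/(2c)`: the P-bracket and the B-bracket of the benches), so T⁗(c, L, κ₀, θ) + Γ3′ + Γ4 + that fit give ★A at the canonical budgets. -/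
theorem approachC_of_TQ_brackets {c L κ₀ θ : ℝ} {aT aRest : Budget} (hc : 0 < c) (hL : 0 ≤ L) (hθ : 0 ≤ θ)
    (hT : TouchedDissipationLawTQ c L κ₀ θ) (hrise : TouchRiseLawWQ (weightedConstQ c θ) L κ₀ aT)
    (hrest : ClassLawQ (diffClass ApproachLevelQ (BetaLevelQ κ₀)) aRest)
    (hfit : ∀ (η : ℝ) (f : ℂ → ℂ) (x₀ s hmax R Hs : ℝ) (B : ℕ), EngineHyps5 2 η f x₀ s hmax R Hs B →
      (1 + 2 * L + 2 * L ^ 2) / (2 * c) * (Hs / s) ^ 2 + (1 + 2 * L + 2 * L ^ 2) / (2 * c) * θ * ((B : ℝ) + 1)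
        + aT η f x₀ s hmax R Hs B + aRest η f x₀ s hmax R Hs B ≤ approachBudgetHalfQ riseSupQ consSupQ η f x₀ s hmax R Hs B) :
    ApproachAllowanceQ (approachBudgetHalfQ riseSupQ consSupQ) := by
  refine approachC_of_TW (fun η f x₀ s hmax R Hs B _ => weightedConstQ_pos hc θ η f x₀ s hmax R Hs B) hL hT hrise hrest
    (fun η f x₀ s hmax R Hs B hE => ?_)
  have hs : 0 < s := hE.2.2.2.1
  have hq : 0 ≤ 1 + 2 * L + 2 * L ^ 2 := by nlinarith
  have hw := frameWeightQ_le hθ η f x₀ s hmax R Hs B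
  have hw0 := frameWeightQ_pos θ η f x₀ s hmax R Hs B
  -- `(Hs/s)²·(s/Hs)² ≤ 1` (`= 1` unless `Hs = 0`, when it is `0`)
  have hprod : (Hs / s) ^ 2 * (s / Hs) ^ 2 ≤ 1 := by
    by_cases hHs : Hs = 0
    · rw [hHs]; simp
    · rw [← mul_pow, div_mul_div_comm, mul_comm Hs s, div_self (mul_ne_zero hs.ne' hHs)]; norm_num
  have hp : betaPurseWQ (weightedConstQ c θ) L η f x₀ s hmax R Hs B
      = (1 + 2 * L + 2 * L ^ 2) / (2 * c) * (Hs / s) ^ 2 * frameWeightQ θ η f x₀ s hmax R Hs B := by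
    rw [betaPurseWQ_apply]; unfold weightedConstQ; field_simp
  have hb : betaPurseWQ (weightedConstQ c θ) L η f x₀ s hmax R Hs B
      ≤ (1 + 2 * L + 2 * L ^ 2) / (2 * c) * (Hs / s) ^ 2 + (1 + 2 * L + 2 * L ^ 2) / (2 * c) * θ * ((B : ℝ) + 1) := by
    rw [hp]
    have hφ0 : 0 ≤ (1 + 2 * L + 2 * L ^ 2) / (2 * c) * (Hs / s) ^ 2 := by positivity
    calc (1 + 2 * L + 2 * L ^ 2) / (2 * c) * (Hs / s) ^ 2 * frameWeightQ θ η f x₀ s hmax R Hs B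
        ≤ (1 + 2 * L + 2 * L ^ 2) / (2 * c) * (Hs / s) ^ 2 * (1 + θ * ((B : ℝ) + 1) * (s / Hs) ^ 2) :=
          mul_le_mul_of_nonneg_left hw hφ0
      _ = (1 + 2 * L + 2 * L ^ 2) / (2 * c) * (Hs / s) ^ 2
          + (1 + 2 * L + 2 * L ^ 2) / (2 * c) * θ * ((B : ℝ) + 1) * ((Hs / s) ^ 2 * (s / Hs) ^ 2) := by ring
      _ ≤ (1 + 2 * L + 2 * L ^ 2) / (2 * c) * (Hs / s) ^ 2 + (1 + 2 * L + 2 * L ^ 2) / (2 * c) * θ * ((B : ℝ) + 1) * 1 := by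
          have hk : 0 ≤ (1 + 2 * L + 2 * L ^ 2) / (2 * c) * θ * ((B : ℝ) + 1) := by positivity
          linarith [mul_le_mul_of_nonneg_left hprod hk]
      _ = _ := by ring
  linarith [hfit η f x₀ s hmax R Hs B hE]

end RhW08.TouchedGlueW
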